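import Summits.BirchSwinnertonDyer.BirchSwinnertonDyer.Theorems.AdditiveKolyvaginRoadLowerHalfTwistOfKuriharaRoad
import Summits.BirchSwinnertonDyer.Rank1Residual.X4.KuriharaClasswide
import Summits.BirchSwinnertonDyer.Rank1Residual.X4.KuriharaLowerHalf
import HarnessLib

/-!
# Route `AdditiveKolyvaginRoad`, crux KS′ `LevelKolyvaginSystemsAdditive` (item stmt-BirchSwinnertonDyer-21396) ≡ KPA′ (21400):
# the KURIHARA ROAD to the lower half LOW₀ IN THE TREE'S OWN CURRENCY — Kim's structure theorem (a HELD Literature named fact)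
# instead of an abstract Kim–Nakamura-shaped hypothesis
# (cell `pub/bsd-wall`, width seat `bsd-wall-akr-p2x-w4` g7; `--supports stmt-BirchSwinnertonDyer-21396`, helper)

THEOREMS ONLY (no definition, no named fact, no `sorry`).  BSD is not proved by any of this; KS′ and KPA′ stay OPEN at `p² ∣ N`;
Kim's theorem is NOT asserted (it enters as the displayed hypothesis `hKim`, an EXISTING Literature named fact), and Kurihara's
non-vanishing conjecture is NOT asserted (displayed hypotheses `hTw` ∕ `hKur`, phrased with the tree's typed conjecture
`Summit.BirchSwinnertonDyer.Rank1Residual.X4.KuriharaUnitAt`).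

THE POINT.  Width seat w4 g6 landed the Kurihara road of crux card `Ideas/kurihara-lower-half.md` as the door
`KuriharaRoad.lowerHalf_twist_of_kuriharaRoad` (file `…LowerHalfTwistOfKuriharaRoad`): LOW₀ for the Heegner twists `E^{(d_K)}` from a
Kim–Nakamura-SHAPED implication `hKN` (arXiv:1808.07726 Thm 1.7, abstract, `7 < p`, a non-anomaly binder at the multiplicative primes,
a rational plus-symbol table) and an abstract Kurihara clause `Kur`, «once a Literature port makes `hKN` a named fact».  That port
ALREADY EXISTS in the tree, in a stronger and more general currency, and is used here BY NAME:

* C.-H. Kim, *The structure of Selmer groups and the Iwasawa main conjecture for elliptic curves*, Amer. J. Math. 148 (2026) 79–129,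
  Thm. 1.8 (6) (= arXiv:2203.12159v4 Thm. 1.9 (6)), analytic rank `0`, ANY reduction type at `p ≥ 5` (additive included — the
  additive local computation is Kim–Nakamura's), `ρ̄_{E,p}` onto, Manin constant prime to `p`: a UNIT mod-`p` Kurihara number
  `δ̃_n` at a cyclic Kolyvagin level gives `ord_p (L(E,1)/Ω_E) = ord_p #Ш(E/ℚ)(p)` — Literature named fact
  `Kim2022_rankZero_padicValRat_sha_of_kuriharaNumber_ne_zero_of_maninConstant` (`Literature/…/KuriharaNumberKimShaLength.lean`),
  with the tree's genuine Kurihara numbers `ModularForms.kuriharaNumber f (p^k) n ψ`, Kolyvagin levels `Kato.IsKolyvaginProduct`,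
  and its LOWER-only level-`k` reading `Kim2026.rankZero_le_padicValNat_sha_of_kuriharaNumber_ne_zero`
  (`Literature/…/Kim2026/ShaLengthRankZeroLowerBound.lean`);
* the residual cell b2b-bsdres's typed conjecture `X4.KuriharaUnitAt W p f` («some unit mod-`p` Kurihara number at a cyclic level»,
  Kim Thm. 1.10 (1) ∕ Kurihara's conjecture ∕ Sakamoto Conj. 1.1) and its per-pair consumers
  `X4.bsdp_of_kuriharaUnitAt_of_analyticRank_eq_zero` (⟹ `BSDp`) and `X4.missingLowerBoundAt_rankZero_of_kimLower` (⟹ LOW).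

So the crux card's two typed `Prop`s are subsumed by tree objects: `KimNakamuraToLowerHalf` by Kim's clause (6) (no `7 < p`, no
`p ∤ (ℓ−1)(ℓ+1)` binder, no separate plus-symbol table — the period transfer `Ω(W) = u·Ω⁺_f`, `|u|_p = 1`, is the binder the Kim facts
carry), and C⁺ `KuriharaNonvanishingRankZeroAdditive` by `X4.KuriharaUnitAt` on the same rows.  This file composes them with the
frame transport `KuriharaRoad.twist_binders_of_frame` (w4 g6) and the socket `exists_kolyvaginClass_ne_zero_of_lowerHalves` (w5 g6, p638284):

* §1 `bsdp_twist_of_kuriharaUnitAt` — at a ♯ frame (`p ≥ 5` additive, `ρ̄` onto, non-CM, `p ∤ ∏ c_ℓ`, Heegner `K` with `d_K` odd,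
  `L(E^{(d_K)},1) ≠ 0`, modularity): `hKim` + GZK + for each globally minimal twist model `Wd` a Manin-good parametrisation datum with
  `p`-adic-unit period ratio and `X4.KuriharaUnitAt Wd p D.f` ⟹ `BSDp Wd p` (the FULL `p`-part for the twist, not only its lower half);
  `lowerHalf_twist_of_kuriharaUnitAt` — hence the socket's binder `hlowTw` VERBATIM; `lowerHalf_twist_of_kimLower` — the same `hlowTw`
  from the LOWER-only level-`k` fact (the minimal input: clause (6) read as an inequality).
* §2 `exists_kolyvaginClass_ne_zero_of_lowerHalf_of_kuriharaUnitAt` — the frame corollary through the socket: PUB + LOW₁ for `E` + `hKim`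
  + the twist supply ⟹ a non-zero mod-`p` Kolyvagin class at some Kolyvagin level — the conclusion of KPA′ ∕ of the line's stub
  `stub_kolyvaginPrimitiveAboveBottom` at that frame, now at EVERY `p ≥ 5` (w4 g6's door needed `7 < p`).
* §3 `kolyvaginPrimitiveAdditive_of_low1_of_kuriharaUnitSupply`, `levelKolyvaginSystemsAdditive_of_low1_of_kuriharaUnitSupply` — class
  level against the route's decls: PUB + McCallum's divisibility half + LOW₁ (the ♯ rank-one rows, verbatim as in
  `kolyvaginPrimitiveAdditive_of_lowerHalves`) + `hKim` + Manin-good data (`hMan`) + Kurihara's conjecture `X4.KuriharaUnitAt` on the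
  non-CM additive `ρ̄`-onto rank-`0` rows with `p ∤ ∏ c_ℓ` (`hKur`) ⟹ KPA′, and ⟹ KS′ through w4 g2's input-free door.

NET CHANGE versus w4 g6's door, by name: the anonymous `hKN` becomes ONE HELD Literature fact (audit: `proof.conditional` on a named
fact), LOW₀ for the twists needs no Kim–Nakamura port, no `7 < p`, no non-anomaly binder; what remains displayed on the rank-`0` side is
exactly {Kim 2026 Thm 1.8 (6) (print, held), GZK + modularity (print), a Manin-good parametrisation with `p`-unit period ratio (PUB-type:
modularity + Manin `c ⊥ p` at `p² ∣ N`), Kurihara's conjecture `X4.KuriharaUnitAt` (research; decidable row by row — kit j312136 of the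
card: 33∕40 pair levels non-zero on the four ♯ calibration rows at `p = 5`)} — and LOW₁ for `E` (research, untouched).

HONEST FRAMING: conditional on every displayed binder; nothing is booked; the X4 cell's labels are unchanged (per pair, `KuriharaUnitAt`
is Kurihara's conjecture; class-wide it is Kato's IMC by Kim Thm. 1.10).  References (locators only): [cite: Kim2022StructureSelmer,
Thm. 1.9 (6), Thm. 1.11 (arXiv v4) = Thm. 1.8 (6), Thm. 1.10 (journal)]; [cite: KimNakamura2020, Thm 1.7] = arXiv:1808.07726;
[cite: Kurihara2014, §1]; [cite: JetchevSkinnerWan2017, §7.4.1, §7.4.3]; [cite: McCallumLMS1991, §5 Cor. 5.6]; [cite: WZhang2014, Thm. 1.1].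
-/

-- single-conjunct summit: `Summit.BirchSwinnertonDyer.BirchSwinnertonDyer.…` repeats the name by design
set_option linter.dupNamespace false
set_option autoImplicit false

noncomputable section

open scoped Classical

namespace Summit.BirchSwinnertonDyer.BirchSwinnertonDyer.Theorems.AdditiveKoly.KuriharaRoad

open WeierstrassCurve NumberField CongruenceSubgroup
  Literature.NumberTheory.EllipticCurves Literature.NumberTheory.EllipticCurves.ModularForms
  Literature.NumberTheory.EllipticCurves.Rank1Residual Literature.NumberTheory.EllipticCurves.Rank1Residual.Typed
  Summit.BirchSwinnertonDyer.Rank1Residual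
  Summit.BirchSwinnertonDyer.BirchSwinnertonDyer.Theses.AdditiveKolyvaginRoad
  Summit.BirchSwinnertonDyer.BirchSwinnertonDyer.Theorems.AdditiveKolyvaginKernel

variable (W : WeierstrassCurve ℚ) [W.IsElliptic] [W.IsGloballyMinimal]
  (p : ℕ) [hp : Fact p.Prime] (K : Type) [Field K] [NumberField K]

/-! ## §1 The twist: `BSD_p` and the lower half from Kim's structure theorem and a unit Kurihara number -/

/-- **`BSD_p` FOR THE HEEGNER TWIST FROM KIM'S STRUCTURE THEOREM AND A UNIT KURIHARA NUMBER, BY NAME.**  At a frame — `E = W/ℚ`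
globally minimal, `p ≥ 5` additive (`hadd`) with `ρ̄_{E,p}` onto, non-CM, `p ∤ ∏ c_ℓ(E)`; `K` imaginary quadratic with `d_K` odd and the
Heegner hypothesis for `N_E`; `L(E^{(d_K)},1) ≠ 0`; modularity `hmod`, Gross–Zagier–Kolyvagin `hGZK` — ASSUME Kim, Amer. J. Math. 148 (2026)
Thm. 1.8 (6) in analytic rank `0` at any reduction type (the Literature named fact
`Kim2022_rankZero_padicValRat_sha_of_kuriharaNumber_ne_zero_of_maninConstant`, binder `hKim`) and, for every globally minimal model
`Wd = Cd • E^{(d_K)}`, a modular parametrisation datum `D` of `Wd` with Manin constant prime to `p`, period ratio `Ω(Wd) = u·Ω⁺_{D.f}` with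
`|u|_p = 1`, and a unit mod-`p` Kurihara number at a cyclic Kolyvagin level (`X4.KuriharaUnitAt Wd p D.f`, Kurihara's conjecture for the
pair; binder `hTw`).  THEN Miller's `BSDp Wd p` holds for every such `Wd`.  Proof: `twist_binders_of_frame` (w4 g6) makes `Wd` a non-CM
additive X4 row of analytic rank `0` with `ρ̄` onto and `p ∤ ∏ c_ℓ(Wd)`; then the b2b-bsdres consumer
`X4.bsdp_of_kuriharaUnitAt_of_analyticRank_eq_zero`.  Conditional on every binder; nothing is booked.
[cite: Kim2022StructureSelmer, Thm. 1.9 (6) and Thm. 1.11 (1) (arXiv v4, PDF p. 8)] [cite: JetchevSkinnerWan2017, §7.4.1 (eq:tamK)]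
[cite: Miller2011LMS, Def. 1.1] -/
theorem bsdp_twist_of_kuriharaUnitAt
    (hKim : Kim2022_rankZero_padicValRat_sha_of_kuriharaNumber_ne_zero_of_maninConstant)
    (hGZK : rank_eq_analyticRank_of_analyticRank_le_one) (hmod : hasEntireLFunction_rat)
    (hp5 : 5 ≤ p) (hadd : Addv W p) (hs : W.HasSurjectiveModNGaloisRep p) (hCM : ¬ W.HasCM)
    (htam : ¬ p ∣ W.tamagawaProduct)
    (hK : IsImaginaryQuadratic K) (hodd : Odd (NumberField.discr K)) (hH : SatisfiesHeegnerHypothesis (W.conductorNorm ℤ) K)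
    (hL : (W.quadraticTwist (NumberField.discr K : ℚ)).entireLFunction 1 ≠ 0)
    (hTw : ∀ (Wd : WeierstrassCurve ℚ) [Wd.IsElliptic] [Wd.IsGloballyMinimal] (Cd : VariableChange ℚ),
      Cd • W.quadraticTwist (NumberField.discr K : ℚ) = Wd →
      ∃ (N : ℕ) (_ : NeZero N) (D : ModularParametrizationData Wd N),
        ¬ (p : ℤ) ∣ D.maninConstant ∧ (∃ u : ℚ, ‖(u : ℚ_[p])‖ = 1 ∧ Wd.realPeriodRat = u * plusPeriod D.f) ∧
          X4.KuriharaUnitAt Wd p D.f) :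
    ∀ (Wd : WeierstrassCurve ℚ) [Wd.IsElliptic] [Wd.IsGloballyMinimal] (Cd : VariableChange ℚ),
      Cd • W.quadraticTwist (NumberField.discr K : ℚ) = Wd → BSDp Wd p := by
  intro Wd _ _ Cd hWd
  have hp2 : p ≠ 2 := by omega
  obtain ⟨hCMd, haddd, hr0, hsd, htamd, -⟩ :=
    twist_binders_of_frame W p K hmod hp2 hadd hs hCM htam hK hodd hH hL Wd Cd hWd
  obtain ⟨N, hN, D, hc, hper, hKur⟩ := hTw Wd Cd hWd
  haveI := hN
  have hirr : Wd.HasIrreducibleModPGaloisRep p := hasIrreducibleModPGaloisRep_of_hasSurjectiveModNGaloisRep Wd p hsd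
  have hX : ClassX4 Wd p := ⟨hp2, haddd, hirr⟩
  exact X4.bsdp_of_kuriharaUnitAt_of_analyticRank_eq_zero Wd p hKim hGZK hmod hp5 hX hsd hr0 D hc hper htamd hKur

/-- **LOW₀ FOR THE TWIST — the socket's binder `hlowTw` VERBATIM — from Kim's structure theorem and a unit Kurihara number.**  Same
hypotheses as `bsdp_twist_of_kuriharaUnitAt`; conclusion `Typed.MissingLowerBoundAt Wd p` (`ord_p #Ш(Wd)_an ≤ ord_p #Ш(Wd)`) for every
globally minimal model `Wd = Cd • E^{(d_K)}` — exactly the shape consumed by `exists_kolyvaginClass_ne_zero_of_lowerHalves` (p638284).  This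
is w4 g6's `lowerHalf_twist_of_kuriharaRoad` with `hKN :=` Kim's clause (6) (a held Literature fact) and `Kur := X4.KuriharaUnitAt`, at
every `p ≥ 5` and without the non-anomaly binder.  Conditional; nothing is booked.
[cite: Kim2022StructureSelmer, Thm. 1.9 (6) (arXiv v4, PDF p. 8)] [cite: Miller2011LMS, Def. 1.1] -/
theorem lowerHalf_twist_of_kuriharaUnitAt
    (hKim : Kim2022_rankZero_padicValRat_sha_of_kuriharaNumber_ne_zero_of_maninConstant)
    (hGZK : rank_eq_analyticRank_of_analyticRank_le_one) (hmod : hasEntireLFunction_rat)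
    (hp5 : 5 ≤ p) (hadd : Addv W p) (hs : W.HasSurjectiveModNGaloisRep p) (hCM : ¬ W.HasCM)
    (htam : ¬ p ∣ W.tamagawaProduct)
    (hK : IsImaginaryQuadratic K) (hodd : Odd (NumberField.discr K)) (hH : SatisfiesHeegnerHypothesis (W.conductorNorm ℤ) K)
    (hL : (W.quadraticTwist (NumberField.discr K : ℚ)).entireLFunction 1 ≠ 0)
    (hTw : ∀ (Wd : WeierstrassCurve ℚ) [Wd.IsElliptic] [Wd.IsGloballyMinimal] (Cd : VariableChange ℚ),
      Cd • W.quadraticTwist (NumberField.discr K : ℚ) = Wd →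
      ∃ (N : ℕ) (_ : NeZero N) (D : ModularParametrizationData Wd N),
        ¬ (p : ℤ) ∣ D.maninConstant ∧ (∃ u : ℚ, ‖(u : ℚ_[p])‖ = 1 ∧ Wd.realPeriodRat = u * plusPeriod D.f) ∧
          X4.KuriharaUnitAt Wd p D.f) :
    ∀ (Wd : WeierstrassCurve ℚ) [Wd.IsElliptic] [Wd.IsGloballyMinimal] (Cd : VariableChange ℚ),
      Cd • W.quadraticTwist (NumberField.discr K : ℚ) = Wd → MissingLowerBoundAt Wd p := by
  intro Wd _ _ Cd hWd
  have hp2 : p ≠ 2 := by omega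
  obtain ⟨-, -, hr0, -⟩ := twist_binders_of_frame W p K hmod hp2 hadd hs hCM htam hK hodd hH hL Wd Cd hWd
  have hB : BSDp Wd p :=
    bsdp_twist_of_kuriharaUnitAt W p K hKim hGZK hmod hp5 hadd hs hCM htam hK hodd hH hL hTw Wd Cd hWd
  obtain ⟨-, hfin⟩ := hGZK Wd (by rw [hr0]; exact zero_le_one)
  haveI : Finite Wd.sha := hfin
  exact (lower_and_upper_of_missingPPartAt Wd p (missingPPartAt_of_bsdp Wd p hB)).1

/-- **LOW₀ FOR THE TWIST FROM THE LOWER-ONLY READING OF KIM'S CLAUSE (6) — the minimal named input.**  As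
`lowerHalf_twist_of_kuriharaUnitAt`, but with the Literature fact `Kim2026.rankZero_le_padicValNat_sha_of_kuriharaNumber_ne_zero` (Kim 2026
Thm. 1.8 (6) at a level `n ∈ 𝒩_k` read as the INEQUALITY `ord_p(L(E,1)/Ω) ≤ ord_p #Ш(p) + (k − 1)`, any reduction type), used at `k = 1`
(on a ♯ frame `p ∤ ∏ c_ℓ(Wd)`, so the Tamagawa level is `1` and the unit certificate of `X4.KuriharaUnitAt` is the informative one); the
per-pair step is b2b-bsdres's `X4.missingLowerBoundAt_rankZero_of_kimLower`.  Conclusion: the socket's `hlowTw` VERBATIM.  Conditional;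
nothing is booked. [cite: Kim2022StructureSelmer, Thm. 1.9 (6) (arXiv v4, PDF p. 8) and §1.5.1 (PDF p. 7)] [cite: Miller2011LMS, Def. 1.1] -/
theorem lowerHalf_twist_of_kimLower
    (hKim : Kim2026.rankZero_le_padicValNat_sha_of_kuriharaNumber_ne_zero)
    (hGZK : rank_eq_analyticRank_of_analyticRank_le_one) (hmod : hasEntireLFunction_rat)
    (hp5 : 5 ≤ p) (hadd : Addv W p) (hs : W.HasSurjectiveModNGaloisRep p) (hCM : ¬ W.HasCM)
    (htam : ¬ p ∣ W.tamagawaProduct)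
    (hK : IsImaginaryQuadratic K) (hodd : Odd (NumberField.discr K)) (hH : SatisfiesHeegnerHypothesis (W.conductorNorm ℤ) K)
    (hL : (W.quadraticTwist (NumberField.discr K : ℚ)).entireLFunction 1 ≠ 0)
    (hTw : ∀ (Wd : WeierstrassCurve ℚ) [Wd.IsElliptic] [Wd.IsGloballyMinimal] (Cd : VariableChange ℚ),
      Cd • W.quadraticTwist (NumberField.discr K : ℚ) = Wd →
      ∃ (N : ℕ) (_ : NeZero N) (D : ModularParametrizationData Wd N),
        ¬ (p : ℤ) ∣ D.maninConstant ∧ (∃ u : ℚ, ‖(u : ℚ_[p])‖ = 1 ∧ Wd.realPeriodRat = u * plusPeriod D.f) ∧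
          X4.KuriharaUnitAt Wd p D.f) :
    ∀ (Wd : WeierstrassCurve ℚ) [Wd.IsElliptic] [Wd.IsGloballyMinimal] (Cd : VariableChange ℚ),
      Cd • W.quadraticTwist (NumberField.discr K : ℚ) = Wd → MissingLowerBoundAt Wd p := by
  intro Wd _ _ Cd hWd
  have hp2 : p ≠ 2 := by omega
  obtain ⟨-, -, hr0, hsd, -, -⟩ := twist_binders_of_frame W p K hmod hp2 hadd hs hCM htam hK hodd hH hL Wd Cd hWd
  obtain ⟨N, hN, D, hc, hper, n, hn0, hn, hcyc, ψ, hψ, hδ⟩ := hTw Wd Cd hWd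
  haveI := hN
  haveI := hn0
  have hLd : Wd.entireLFunction 1 ≠ 0 := (Wd.analyticRank_eq_zero_iff_holds (hmod Wd)).mp hr0
  exact X4.missingLowerBoundAt_rankZero_of_kimLower Wd p hKim hGZK hp5 hsd hLd D hc hper 1 n le_rfl (by omega) hn hcyc ψ hψ hδ

/-! ## §2 The frame corollary through the socket p638284 -/

/-- **KOLYVAGIN'S CONJECTURE MOD `p` AT A ♯ FRAME FROM LOW₁ AND THE KURIHARA ROAD IN TREE CURRENCY (any `p ≥ 5`).**  The ♯ frame of KPA′
(globally minimal non-CM `E`, `p ≥ 5` additive with `ρ̄` onto, `p ∤ ∏ c_ℓ`, `r_an(E) = 1`; `K` imaginary quadratic, `d_K` odd, `d_K < −4`,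
Heegner for `N_E`, `L(E^{(d_K)},1) ≠ 0`; `(Dt, β, ι)` with `4N ∣ β² − d_K`, `p ∤ c(Dt)`); the published inputs of the socket (Gross–Zagier,
Kolyvagin, Kolyvagin's bound, GZK, modularity, McCallum Cor. 5.6); Kim's clause (6) (`hKim`, held named fact); the twist supply `hTw`
(Manin-good parametrisation with `p`-unit period ratio and `X4.KuriharaUnitAt` for each minimal twist model); and LOW₁ for `E` (`hlow`;
the Kurihara road is LOW₀-only).  THEN some Kolyvagin–Heegner datum at some Kolyvagin level has a non-zero mod-`p` class — the conclusion
of KPA′ and of `stub_kolyvaginPrimitiveAboveBottom` at this frame.  `= exists_kolyvaginClass_ne_zero_of_lowerHalves` with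
`hlowTw := lowerHalf_twist_of_kuriharaUnitAt`.  CONDITIONAL on every binder; nothing is booked.
[cite: Kim2022StructureSelmer, Thm. 1.9 (6)] [cite: JetchevSkinnerWan2017, §7.4.3] [cite: McCallumLMS1991, §5 Cor. 5.6] -/
theorem exists_kolyvaginClass_ne_zero_of_lowerHalf_of_kuriharaUnitAt [NeZero (W.conductorNorm ℤ)]
    (Dt : ModularParametrizationData W (W.conductorNorm ℤ)) (β : ℤ) (ι : K →+* ℂ)
    -- published inputs (named facts of the tree)
    (hGZ : gross_zagier (W.conductorNorm ℤ) W K) (hKo : kolyvagin (W.conductorNorm ℤ) W K)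
    (hKoB : Kolyvagin1990_padicValNat_card_sha_le (W.conductorNorm ℤ) W K)
    (hGZK : rank_eq_analyticRank_of_analyticRank_le_one) (hmod : hasEntireLFunction_rat)
    (hMc : McCallum1991_padicValNat_card_sha_primary_add_le_of_globalDivisibility)
    -- Kim's structure theorem, clause (6), analytic rank 0, any reduction (named fact of the tree)
    (hKim : Kim2022_rankZero_padicValRat_sha_of_kuriharaNumber_ne_zero_of_maninConstant)
    -- the twist supply: Manin-good parametrisation, p-unit period ratio, unit Kurihara number (displayed, not asserted)
    (hTw : ∀ (Wd : WeierstrassCurve ℚ) [Wd.IsElliptic] [Wd.IsGloballyMinimal] (Cd : VariableChange ℚ),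
      Cd • W.quadraticTwist (NumberField.discr K : ℚ) = Wd →
      ∃ (N : ℕ) (_ : NeZero N) (D : ModularParametrizationData Wd N),
        ¬ (p : ℤ) ∣ D.maninConstant ∧ (∃ u : ℚ, ‖(u : ℚ_[p])‖ = 1 ∧ Wd.realPeriodRat = u * plusPeriod D.f) ∧
          X4.KuriharaUnitAt Wd p D.f)
    -- the frame
    (hp5 : 5 ≤ p) (hadd : Addv W p) (hs : W.HasSurjectiveModNGaloisRep p) (hCM : ¬ W.HasCM)
    (htam : ¬ p ∣ W.tamagawaProduct) (hr : W.analyticRank = 1)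
    (hK : IsImaginaryQuadratic K) (hodd : Odd (NumberField.discr K)) (hlt : NumberField.discr K < -4)
    (hH : SatisfiesHeegnerHypothesis (W.conductorNorm ℤ) K)
    (hL : (W.quadraticTwist (NumberField.discr K : ℚ)).entireLFunction 1 ≠ 0)
    (hβ : (4 * (W.conductorNorm ℤ : ℤ)) ∣ β ^ 2 - NumberField.discr K) (hc : ¬ (p : ℤ) ∣ Dt.c)
    -- LOW₁ for `E`
    (hlow : MissingLowerBoundAt W p) :
    ∃ (n : ℕ) (d : KolyvaginHeegnerData Dt β ι n),
      KolyvaginDescent.KolSupp (Zhang2014.IsKolyvaginPrime (W.conductorNorm ℤ) W K p) n ∧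
        d.kolyvaginClass hp.out 1 ≠ 0 :=
  exists_kolyvaginClass_ne_zero_of_lowerHalves W p K Dt β ι hGZ hKo hKoB hGZK hmod hMc hp5 hadd hs hCM htam hr hK hodd
    hlt hH hL hβ hc hlow
    (lowerHalf_twist_of_kuriharaUnitAt W p K hKim hGZK hmod hp5 hadd hs hCM htam hK hodd hH hL hTw)

/-! ## §3 Class level, against the route's decls: `PUB → McCallum → Kim (6) → Manin data → Kurihara's conjecture → LOW₁ → KPA′ → KS′` -/

/-- **CRUX r2 `KolyvaginPrimitiveAdditive` FROM LOW₁ AND THE KURIHARA ROAD IN TREE CURRENCY.**  Modulo the route's published inputs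
(`PublishedInputsAdditiveKoly`: Gross–Zagier, Kolyvagin, Kolyvagin's bound, GZK, modularity are used) and McCallum's Cor. 5.6 divisibility
half; Kim 2026 Thm. 1.8 (6) in analytic rank `0` (`hKim`, held named fact); `hMan`: every non-CM additive analytic-rank-`0` row at `p ≥ 5`
with `ρ̄` onto carries a modular parametrisation datum with Manin constant prime to `p` and `p`-adic-unit period ratio (PUB-type: modularity
+ Manin); `hKur`: Kurihara's conjecture `X4.KuriharaUnitAt` on the non-CM additive `ρ̄`-onto analytic-rank-`0` rows with `p ∤ ∏ c_ℓ`, for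
every parametrisation datum (research; the card's C⁺ in the tree's currency); and LOW₁ (`h₁`): the lower half at every ♯ additive
analytic-rank-`1` row (verbatim the binder of `kolyvaginPrimitiveAdditive_of_lowerHalves`).  CONCLUSION: `KolyvaginPrimitiveAdditive`
(frame by frame via §1 and the socket; non-CM from a multiplicative prime ♠(2)).  CONDITIONAL on all six antecedents; LOW₁ and
`KuriharaUnitAt` are OPEN at `p² ∣ N`; nothing is booked. [cite: Kim2022StructureSelmer, Thm. 1.9 (6), Thm. 1.11 (1)]
[cite: JetchevSkinnerWan2017, §7.4.1, §7.4.3] [cite: McCallumLMS1991, §5 Cor. 5.6 (p. 310)] [cite: WZhang2014, Thm. 1.1, Remark 5] -/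
theorem kolyvaginPrimitiveAdditive_of_low1_of_kuriharaUnitSupply (hPub : PublishedInputsAdditiveKoly)
    (hMc : McCallum1991_padicValNat_card_sha_primary_add_le_of_globalDivisibility)
    (hKim : Kim2022_rankZero_padicValRat_sha_of_kuriharaNumber_ne_zero_of_maninConstant)
    (hMan : ∀ (X : WeierstrassCurve ℚ) [X.IsElliptic] [X.IsGloballyMinimal] (p : ℕ) [Fact p.Prime],
      ¬ X.HasCM → 5 ≤ p → Addv X p → X.HasSurjectiveModNGaloisRep p → X.analyticRank = 0 →
      ∃ (N : ℕ) (_ : NeZero N) (D : ModularParametrizationData X N),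
        ¬ (p : ℤ) ∣ D.maninConstant ∧ ∃ u : ℚ, ‖(u : ℚ_[p])‖ = 1 ∧ X.realPeriodRat = u * plusPeriod D.f)
    (hKur : ∀ (X : WeierstrassCurve ℚ) [X.IsElliptic] [X.IsGloballyMinimal] (p : ℕ) [Fact p.Prime]
      {N : ℕ} [NeZero N] (D : ModularParametrizationData X N),
      ¬ X.HasCM → 5 ≤ p → Addv X p → X.HasSurjectiveModNGaloisRep p → ¬ p ∣ X.tamagawaProduct →
      X.analyticRank = 0 → X4.KuriharaUnitAt X p D.f)
    (h₁ : ∀ (W : WeierstrassCurve ℚ) [W.IsElliptic] [W.IsGloballyMinimal] (p : ℕ) [Fact p.Prime],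
      ¬ W.HasCM → 5 ≤ p → Addv W p → W.analyticRank = 1 → W.HasSurjectiveModNGaloisRep p →
      (∀ (ℓ : ℕ) [Fact ℓ.Prime], W.HasMultiplicativeReductionAtPrime ℓ →
        ¬ p ∣ padicValInt ℓ W.minimalDiscriminantInt) →
      (∃ (ℓ₁ ℓ₂ : ℕ) (_ : Fact ℓ₁.Prime) (_ : Fact ℓ₂.Prime), ℓ₁ ≠ ℓ₂ ∧
        W.HasMultiplicativeReductionAtPrime ℓ₁ ∧ W.HasMultiplicativeReductionAtPrime ℓ₂) →
      ¬ p ∣ W.tamagawaProduct → MissingLowerBoundAt W p) :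
    Summit.BirchSwinnertonDyer.BirchSwinnertonDyer.Theses.AdditiveKolyvaginRoad.KolyvaginPrimitiveAdditive := by
  intro W _ _ _ p _ K _ _ Dt β ι hp5 hadd hs hsp htwo htam hr hK hodd hlt hH hL hβ hc
  obtain ⟨hGZ, hKo, hKoB, hGZK, hmod, -⟩ := hPub
  -- non-CM from a multiplicative prime
  obtain ⟨ℓ₁, ℓ₂, hℓ₁, hℓ₂, hne, hm₁, hm₂⟩ := htwo
  have hCM : ¬ W.HasCM := not_hasCM_of_hasMultiplicativeReductionAtPrime' W hm₁
  -- LOW₁ at this ♯ rank-one row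
  have hlow : MissingLowerBoundAt W p := h₁ W p hCM hp5 hadd hr hs hsp ⟨ℓ₁, ℓ₂, hℓ₁, hℓ₂, hne, hm₁, hm₂⟩ htam
  -- the twist supply at this frame, from the row-level supplies
  have hTw : ∀ (Wd : WeierstrassCurve ℚ) [Wd.IsElliptic] [Wd.IsGloballyMinimal] (Cd : VariableChange ℚ),
      Cd • W.quadraticTwist (NumberField.discr K : ℚ) = Wd →
      ∃ (N : ℕ) (_ : NeZero N) (D : ModularParametrizationData Wd N),
        ¬ (p : ℤ) ∣ D.maninConstant ∧ (∃ u : ℚ, ‖(u : ℚ_[p])‖ = 1 ∧ Wd.realPeriodRat = u * plusPeriod D.f) ∧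
          X4.KuriharaUnitAt Wd p D.f := by
    intro Wd _ _ Cd hWd
    have hp2 : p ≠ 2 := by omega
    obtain ⟨hCMd, haddd, hr0, hsd, htamd, -⟩ :=
      twist_binders_of_frame W p K hmod hp2 hadd hs hCM htam hK hodd hH hL Wd Cd hWd
    obtain ⟨N, hN, D, hcD, hper⟩ := hMan Wd p hCMd hp5 haddd hsd hr0
    haveI := hN
    exact ⟨N, hN, D, hcD, hper, hKur Wd p D hCMd hp5 haddd hsd htamd hr0⟩
  exact exists_kolyvaginClass_ne_zero_of_lowerHalves W p K Dt β ι (hGZ _ W K) (hKo _ W K) (hKoB _ W K) hGZK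
    hmod hMc hp5 hadd hs hCM htam hr hK hodd hlt hH hL hβ hc hlow
    (lowerHalf_twist_of_kuriharaUnitAt W p K hKim hGZK hmod hp5 hadd hs hCM htam hK hodd hH hL hTw)

/-- **CRUX r8 `LevelKolyvaginSystemsAdditive` (item stmt-BirchSwinnertonDyer-21396) FROM LOW₁ AND THE KURIHARA ROAD IN TREE CURRENCY**:
`kolyvaginPrimitiveAdditive_of_low1_of_kuriharaUnitSupply` followed by w4 g2's input-free door
`levelKolyvaginSystemsAdditive_of_kolyvaginPrimitiveAdditive_free` (KPA′ → KS′ at the Poitou–Tate THEOREM).  Same six antecedents (PUB,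
McCallum's divisibility half, Kim's clause (6), Manin-good data, Kurihara's conjecture on the additive rank-`0` rows, LOW₁); nothing is
booked; KS′ stays OPEN. [cite: WZhang2014, Thm. 1.1, Thm. 4.3, §9] [cite: Kim2022StructureSelmer, Thm. 1.9 (6)] [cite: McCallumLMS1991, §5 Cor. 5.6] -/
theorem levelKolyvaginSystemsAdditive_of_low1_of_kuriharaUnitSupply (hPub : PublishedInputsAdditiveKoly)
    (hMc : McCallum1991_padicValNat_card_sha_primary_add_le_of_globalDivisibility)
    (hKim : Kim2022_rankZero_padicValRat_sha_of_kuriharaNumber_ne_zero_of_maninConstant)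
    (hMan : ∀ (X : WeierstrassCurve ℚ) [X.IsElliptic] [X.IsGloballyMinimal] (p : ℕ) [Fact p.Prime],
      ¬ X.HasCM → 5 ≤ p → Addv X p → X.HasSurjectiveModNGaloisRep p → X.analyticRank = 0 →
      ∃ (N : ℕ) (_ : NeZero N) (D : ModularParametrizationData X N),
        ¬ (p : ℤ) ∣ D.maninConstant ∧ ∃ u : ℚ, ‖(u : ℚ_[p])‖ = 1 ∧ X.realPeriodRat = u * plusPeriod D.f)
    (hKur : ∀ (X : WeierstrassCurve ℚ) [X.IsElliptic] [X.IsGloballyMinimal] (p : ℕ) [Fact p.Prime]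
      {N : ℕ} [NeZero N] (D : ModularParametrizationData X N),
      ¬ X.HasCM → 5 ≤ p → Addv X p → X.HasSurjectiveModNGaloisRep p → ¬ p ∣ X.tamagawaProduct →
      X.analyticRank = 0 → X4.KuriharaUnitAt X p D.f)
    (h₁ : ∀ (W : WeierstrassCurve ℚ) [W.IsElliptic] [W.IsGloballyMinimal] (p : ℕ) [Fact p.Prime],
      ¬ W.HasCM → 5 ≤ p → Addv W p → W.analyticRank = 1 → W.HasSurjectiveModNGaloisRep p →
      (∀ (ℓ : ℕ) [Fact ℓ.Prime], W.HasMultiplicativeReductionAtPrime ℓ →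
        ¬ p ∣ padicValInt ℓ W.minimalDiscriminantInt) →
      (∃ (ℓ₁ ℓ₂ : ℕ) (_ : Fact ℓ₁.Prime) (_ : Fact ℓ₂.Prime), ℓ₁ ≠ ℓ₂ ∧
        W.HasMultiplicativeReductionAtPrime ℓ₁ ∧ W.HasMultiplicativeReductionAtPrime ℓ₂) →
      ¬ p ∣ W.tamagawaProduct → MissingLowerBoundAt W p) :
    Summit.BirchSwinnertonDyer.BirchSwinnertonDyer.Theses.AdditiveKolyvaginRoad.LevelKolyvaginSystemsAdditive :=
  levelKolyvaginSystemsAdditive_of_kolyvaginPrimitiveAdditive_free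
    (kolyvaginPrimitiveAdditive_of_low1_of_kuriharaUnitSupply hPub hMc hKim hMan hKur h₁)

end Summit.BirchSwinnertonDyer.BirchSwinnertonDyer.Theorems.AdditiveKoly.KuriharaRoad

end
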